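import Summits.CriticalPhenomena.PercolationContinuityZ3.Theorems.FK.InfiniteVolumeDefs
import Literature.Probability.LatticeModels.RandomClusterConditionalDomination
import Literature.Probability.LatticeModels.RandomClusterEmbedding
import HarnessLib

/-!
# FK-continuity transplant, FO-06 (interface half): the finite-volume SANDWICH — conditioning a random-cluster
# measure on the configuration off a region, and the transport of a region of `ℤ^d` inside a larger piece

Cell `fk-continuity` (bschramm), row FO-06a-2a; support file for the FK-continuity transplant
(`--supports stmt-CriticalPhenomena-4575`); builds on p205010 (kernel theorem, internal audit signed; external expert
review pending).  Pure proofs over the tree's finite-graph random-cluster measure `rcMeasure` (Grimmett 2006 (1.2),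
wired vertex sets §4.2); the companion `InfiniteVolumeDLR.lean` passes them to the limit `Λ_n ↑ ℤ^d` and discharges the
cell's interface `FKGibbs` (`InfiniteVolumeGibbs.lean`) for the box limits `φ⁰_{p,q}`, `φ¹_{p,q}`.  No definitions of
mathematical content, no named facts, no sorries.

## Contents

* **Summed conditional domination** (Grimmett 2006, Lemma (4.13) with Lemma (4.14)(b), `q ≥ 1`): for an
  increasing event `A` determined by the edges of a region `U ⊆ E(G)` and ANY event `S` determined by the pairs off
  `U`: `rcMeasure_fromEdgeSet_real_mul_le_real_inter` (`φ^B_{⟨U⟩}(A) · φ^B_G(S) ≤ φ^B_G(A ∩ S)`) and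
  `rcMeasure_real_inter_le_fromEdgeSet_real_mul` (`φ^B_G(A ∩ S) ≤ φ^W_{⟨U⟩}(A) · φ^B_G(S)` for `W ⊇ B` containing the
  endpoints of all edges off `U`) — the tree's per-cylinder Holley dominations
  `rcMeasure_real_inter_cylinder_le_mul_fromEdgeSet(_of_isLowerSet)` (`RandomClusterConditionalDomination.lean`)
  summed over the cylinders `{ω ∖ U = ξ}` making up `S` (`measureReal_eq_sum_inter_offCylinder`).
* **A region `Λ ⊆ Δ` of `ℤ^d`**: inner edges vs. `E_Λ = edgesIn (zdGraph d) Λ`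
  (`mem_insideEdges_iff_map_val_mem_edgesIn`), pull-backs along `liftEdges Δ` of events determined by `E_Λ` / off `E_Λ`
  (`mem_preimage_liftEdges_iff_inter`), and the two TRANSPORTS to the measure of the region `Λ` itself: free
  (`rcMeasure_fromEdgeSet_insideEdges_empty_real`, tree `rcMeasure_real_map_image`) and with the tree's `envSet`
  (everything off `Λ` plus `∂Λ`) wired (`rcMeasure_fromEdgeSet_insideEdges_envSet_real`, tree
  `rcMeasure_real_map_of_wired`), with the bookkeeping `wiredBoundary_subset_envSet`,
  `mem_envSet_of_mem_edgeSet_of_notMem_insideEdges`, `wiredBoundary_nonempty_of_edgesIn_nonempty`.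

## References

* G. Grimmett, *The Random-Cluster Model*, Springer 2006: §1.2 (1.2), §4.2 (4.11)–(4.13), Lemma (4.13),
  Lemma (4.14)(b). [Grimmett2006]
-/

noncomputable section

open MeasureTheory Set Filter
open scoped Topology ENNReal

namespace Summit.CriticalPhenomena.PercolationContinuityZ3.Theorems.FK

open Literature.Probability.Percolation Literature.Probability.LatticeModels

/-! ## Finite volume: the sandwich given the configuration off a region (Grimmett 2006, Lemma (4.13) + (4.14)(b)) -/
section FiniteVolume

open Finset SimpleGraph

variable {V : Type*} [Fintype V] [DecidableEq V] (G : SimpleGraph V) [DecidableRel G.Adj]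

omit [DecidableEq V] in
/-- Partition of an event by the configuration off the region `U`: `μ(Y) = ∑_ξ μ(Y ∩ {ω ∖ U = ξ})`, the sum
running over all `ξ` (finitely many; almost all terms vanish). [cite: Grimmett2006, §4.2 (Ω^ξ_Λ)] -/
theorem measureReal_eq_sum_inter_offCylinder (μ : Measure (BondConfig V)) [IsFiniteMeasure μ]
    (U : Set (Sym2 V)) (Y : Set (BondConfig V)) :
    μ.real Y = ∑ ξ : Set (Sym2 V), μ.real (Y ∩ {ω | ω ∩ Uᶜ = ξ}) := by
  classical
  have hY : Y = ⋃ ξ ∈ (Finset.univ : Finset (Set (Sym2 V))), (Y ∩ {ω | ω ∩ Uᶜ = ξ}) := by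
    ext ω
    simp only [Set.mem_iUnion, Finset.mem_univ, Set.mem_inter_iff, Set.mem_setOf_eq, exists_true_left]
    exact ⟨fun h => ⟨ω ∩ Uᶜ, h, rfl⟩, fun ⟨_, h, _⟩ => h⟩
  conv_lhs => rw [hY]
  rw [measureReal_biUnion_finset]
  · intro ξ _ ξ' _ hne
    exact Set.disjoint_left.2 fun ω h h' => hne (h.2.symm.trans h'.2)
  · exact fun ξ _ => MeasurableSet.of_discrete

omit [Fintype V] [DecidableEq V] in
/-- On a cylinder `{ω ∖ U = ξ}` an event determined off `U` is all or nothing. [cite: Grimmett2006, §4.2] -/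
theorem inter_offCylinder_eq_of_mem {U : Set (Sym2 V)} {S : Set (BondConfig V)}
    (hS : ∀ ω, ω ∈ S ↔ ω ∩ Uᶜ ∈ S) {ξ : Set (Sym2 V)} (hξ : ξ ∈ S) (Y : Set (BondConfig V)) :
    Y ∩ S ∩ {ω | ω ∩ Uᶜ = ξ} = Y ∩ {ω | ω ∩ Uᶜ = ξ} := by
  ext ω
  simp only [Set.mem_inter_iff, Set.mem_setOf_eq]
  constructor
  · rintro ⟨⟨hY, -⟩, h⟩; exact ⟨hY, h⟩
  · rintro ⟨hY, h⟩; exact ⟨⟨hY, (hS ω).2 (h.symm ▸ hξ)⟩, h⟩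

omit [Fintype V] [DecidableEq V] in
/-- Off the pattern set of an event determined off `U`, the cylinder misses it. [cite: Grimmett2006, §4.2] -/
theorem inter_offCylinder_eq_empty_of_notMem {U : Set (Sym2 V)} {S : Set (BondConfig V)}
    (hS : ∀ ω, ω ∈ S ↔ ω ∩ Uᶜ ∈ S) {ξ : Set (Sym2 V)} (hξ : ξ ∉ S) (Y : Set (BondConfig V)) :
    Y ∩ S ∩ {ω | ω ∩ Uᶜ = ξ} = ∅ := by
  ext ω
  simp only [Set.mem_inter_iff, Set.mem_setOf_eq, Set.mem_empty_iff_false, iff_false, not_and]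
  intro h hω
  exact hξ (hω ▸ (hS ω).1 h.2)

/-- A cylinder prescribing a non-edge of `G` to be open is null for the random-cluster measure (which lives on
edge sets of `G`). [cite: Grimmett2006, §1.2 eq. (1.2)] -/
theorem rcMeasure_real_offCylinder_eq_zero_of_not_subset {p q : ℝ} (hp : p ∈ Set.Icc (0 : ℝ) 1) (hq : 0 < q)
    (B : Set V) {U ξ : Set (Sym2 V)} (hξ : ¬ ξ ⊆ G.edgeSet) (Y : Set (BondConfig V)) :
    (rcMeasure G p q B).real (Y ∩ {ω | ω ∩ Uᶜ = ξ}) = 0 := by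
  refine le_antisymm ?_ measureReal_nonneg
  have h := rcMeasure_real_mono_on_edgeSets G hp hq B (A := Y ∩ {ω | ω ∩ Uᶜ = ξ}) (A' := ∅)
    (fun ω hωE hω => hξ (fun e he => hωE (by rw [← hω.2] at he; exact he.1)))
  rwa [measureReal_empty] at h

/-- **Lower sandwich in finite volume** (Grimmett 2006, Lemma (4.13) with Lemma (4.14)(b)): for a region
`U ⊆ E(G)`, an increasing event `A` determined by the edges of `U` and an event `S` determined by the pairs off
`U`, `φ^B_{⟨U⟩,p,q}(A) · φ^B_{G,p,q}(S) ≤ φ^B_{G,p,q}(A ∩ S)` (`q ≥ 1`): conditionally on any information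
outside the region, `A` is at least as likely as under the measure of the region alone (with the ambient wiring
`B`; by `rcMeasure_real_mono_wired_of_isUpperSet` a fortiori as under the free measure of the region).  Summed
form of the tree's per-cylinder domination `rcMeasure_real_inter_cylinder_le_mul_fromEdgeSet_of_isLowerSet`.
[cite: Grimmett2006, Lemma (4.13) and Lemma (4.14)(b)] -/
theorem rcMeasure_fromEdgeSet_real_mul_le_real_inter {p q : ℝ} (hp : p ∈ Set.Icc (0 : ℝ) 1) (hq : 1 ≤ q)
    (B : Set V) (U : Finset (Sym2 V)) (hU : U ⊆ G.edgeFinset) {A S : Set (BondConfig V)}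
    (hA : IsUpperSet A) (hAU : ∀ ω, ω ∈ A ↔ ω ∩ ↑U ∈ A) (hS : ∀ ω, ω ∈ S ↔ ω ∩ (↑U : Set (Sym2 V))ᶜ ∈ S) :
    (rcMeasure (fromEdgeSet (U : Set (Sym2 V))) p q B).real A * (rcMeasure G p q B).real S ≤
      (rcMeasure G p q B).real (A ∩ S) := by
  have hq0 : 0 < q := one_pos.trans_le hq
  set μ := rcMeasure G p q B with hμ
  set ν := rcMeasure (fromEdgeSet (U : Set (Sym2 V))) p q B with hν
  haveI : IsProbabilityMeasure μ := isProbabilityMeasure_rcMeasure G hp hq0 B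
  haveI : IsProbabilityMeasure ν := isProbabilityMeasure_rcMeasure _ hp hq0 B
  rw [measureReal_eq_sum_inter_offCylinder μ ↑U S, measureReal_eq_sum_inter_offCylinder μ ↑U (A ∩ S),
    Finset.mul_sum]
  refine Finset.sum_le_sum fun ξ _ => ?_
  by_cases hξ : ξ ∈ S
  · rw [inter_offCylinder_eq_of_mem hS hξ, show S ∩ {ω | ω ∩ (↑U : Set (Sym2 V))ᶜ = ξ} =
        Set.univ ∩ S ∩ {ω | ω ∩ (↑U : Set (Sym2 V))ᶜ = ξ} by rw [Set.univ_inter],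
      inter_offCylinder_eq_of_mem hS hξ, Set.univ_inter]
    set C : Set (BondConfig V) := {ω | ω ∩ (↑U : Set (Sym2 V))ᶜ = ξ} with hC
    -- the tree's domination of the DEcreasing event `Aᶜ` given the cylinder, by the region measure
    have hdom := rcMeasure_real_inter_cylinder_le_mul_fromEdgeSet_of_isLowerSet G hp hq B U hU ξ
      (D := Aᶜ) hA.compl
    have hAc : {ω : BondConfig V | ω ∩ ↑U ∈ Aᶜ} = Aᶜ := by
      ext ω; simp only [Set.mem_setOf_eq, Set.mem_compl_iff, ← hAU ω]
    rw [hAc, ← hμ, ← hν, ← hC] at hdom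
    have hsplit : μ.real (C ∩ A) + μ.real (C \ A) = μ.real C :=
      measureReal_inter_add_sdiff (s := C) MeasurableSet.of_discrete
    have hνc : ν.real Aᶜ = 1 - ν.real A := by
      rw [measureReal_compl MeasurableSet.of_discrete, probReal_univ]
    rw [Set.sdiff_eq_compl_inter, Set.inter_comm C A] at hsplit
    -- μ(A ∩ C) = μ(C) - μ(Aᶜ ∩ C) ≥ μ(C) - μ(C)(1 - ν(A))
    have h1 : μ.real (Aᶜ ∩ C) ≤ μ.real C * (1 - ν.real A) := by rw [← hνc]; exact hdom
    have h2 : μ.real C * (1 - ν.real A) = μ.real C - ν.real A * μ.real C := by ring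
    linarith
  · rw [inter_offCylinder_eq_empty_of_notMem hS hξ, show S ∩ {ω | ω ∩ (↑U : Set (Sym2 V))ᶜ = ξ} =
        Set.univ ∩ S ∩ {ω | ω ∩ (↑U : Set (Sym2 V))ᶜ = ξ} by rw [Set.univ_inter],
      inter_offCylinder_eq_empty_of_notMem hS hξ, measureReal_empty, mul_zero]

/-- **Upper sandwich in finite volume** (Grimmett 2006, Lemma (4.13) with Lemma (4.14)(b)): with `U`, `A`, `S`
as above and a vertex set `W ⊇ B` containing both endpoints of every edge of `G` off `U`,
`φ^B_{G,p,q}(A ∩ S) ≤ φ^W_{⟨U⟩,p,q}(A) · φ^B_{G,p,q}(S)`: conditionally on any information outside the region,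
`A` is at most as likely as under the measure of the region with everything the outside can touch wired.  Summed
form of the tree's `rcMeasure_real_inter_cylinder_le_mul_fromEdgeSet`. [cite: Grimmett2006, Lemma (4.13) and Lemma (4.14)(b)] -/
theorem rcMeasure_real_inter_le_fromEdgeSet_real_mul {p q : ℝ} (hp : p ∈ Set.Icc (0 : ℝ) 1) (hq : 1 ≤ q)
    (B : Set V) (U : Finset (Sym2 V)) (hU : U ⊆ G.edgeFinset) {W : Set V} (hBW : B ⊆ W)
    (hW : ∀ e ∈ G.edgeSet, e ∉ (U : Set (Sym2 V)) → ∀ x ∈ e, x ∈ W)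
    {A S : Set (BondConfig V)}
    (hA : IsUpperSet A) (hAU : ∀ ω, ω ∈ A ↔ ω ∩ ↑U ∈ A) (hS : ∀ ω, ω ∈ S ↔ ω ∩ (↑U : Set (Sym2 V))ᶜ ∈ S) :
    (rcMeasure G p q B).real (A ∩ S) ≤
      (rcMeasure (fromEdgeSet (U : Set (Sym2 V))) p q W).real A * (rcMeasure G p q B).real S := by
  have hq0 : 0 < q := one_pos.trans_le hq
  set μ := rcMeasure G p q B with hμ
  set ν := rcMeasure (fromEdgeSet (U : Set (Sym2 V))) p q W with hν
  haveI : IsProbabilityMeasure μ := isProbabilityMeasure_rcMeasure G hp hq0 B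
  rw [measureReal_eq_sum_inter_offCylinder μ ↑U S, measureReal_eq_sum_inter_offCylinder μ ↑U (A ∩ S),
    Finset.mul_sum]
  refine Finset.sum_le_sum fun ξ _ => ?_
  by_cases hξ : ξ ∈ S
  · rw [inter_offCylinder_eq_of_mem hS hξ, show S ∩ {ω | ω ∩ (↑U : Set (Sym2 V))ᶜ = ξ} =
        Set.univ ∩ S ∩ {ω | ω ∩ (↑U : Set (Sym2 V))ᶜ = ξ} by rw [Set.univ_inter],
      inter_offCylinder_eq_of_mem hS hξ, Set.univ_inter]
    by_cases hξE : ξ ⊆ G.edgeSet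
    · by_cases hξU : Disjoint ξ (↑U : Set (Sym2 V))
      · have hξW : ∀ e ∈ ξ, ∀ x ∈ e, x ∈ W := fun e he =>
          hW e (hξE he) (Set.disjoint_left.1 hξU he)
        have hdom := rcMeasure_real_inter_cylinder_le_mul_fromEdgeSet G hp hq B U hU ξ hBW hξW hA
        have hAe : {ω : BondConfig V | ω ∩ ↑U ∈ A} = A := by
          ext ω; simp only [Set.mem_setOf_eq, ← hAU ω]
        rw [hAe] at hdom
        rw [mul_comm]
        exact hdom
      · -- the cylinder is empty: `ω ∖ U = ξ` forces `ξ ∩ U = ∅`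
        have hC : {ω : BondConfig V | ω ∩ (↑U : Set (Sym2 V))ᶜ = ξ} = ∅ := by
          ext ω
          simp only [Set.mem_setOf_eq, Set.mem_empty_iff_false, iff_false]
          intro hω
          apply hξU
          rw [← hω]
          exact Set.disjoint_left.2 fun e he heU => he.2 heU
        rw [hC, Set.inter_empty, measureReal_empty, mul_zero]
    · rw [rcMeasure_real_offCylinder_eq_zero_of_not_subset G hp hq0 B hξE,
        show ({ω : BondConfig V | ω ∩ (↑U : Set (Sym2 V))ᶜ = ξ}) =
          Set.univ ∩ {ω | ω ∩ (↑U : Set (Sym2 V))ᶜ = ξ} by rw [Set.univ_inter],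
        rcMeasure_real_offCylinder_eq_zero_of_not_subset G hp hq0 B hξE, mul_zero]
  · rw [inter_offCylinder_eq_empty_of_notMem hS hξ, show S ∩ {ω | ω ∩ (↑U : Set (Sym2 V))ᶜ = ξ} =
        Set.univ ∩ S ∩ {ω | ω ∩ (↑U : Set (Sym2 V))ᶜ = ξ} by rw [Set.univ_inter],
      inter_offCylinder_eq_empty_of_notMem hS hξ, measureReal_empty, mul_zero]

end FiniteVolume

/-! ## A finite region `Λ` of `ℤ^d` inside a larger piece `Δ`: regions, events and the two transports -/
section Lattice

open Finset SimpleGraph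

variable {d : ℕ}

/-- An inner edge of `Λ ⊆ Δ` (the tree's `insideEdges`: an edge of `(Δ, E_Δ)` with both endpoints in `Λ`) is
exactly a pair of `Δ` whose underlying lattice pair lies in `E_Λ = edgesIn (zdGraph d) Λ`. [cite: Grimmett2006, §4.2 (E_Λ)] -/
theorem mem_insideEdges_iff_map_val_mem_edgesIn {Λ Δ : Finset (Site d)} (h : Λ ⊆ Δ) (e : Sym2 ↥Δ) :
    e ∈ insideEdges (zdGraph d) h ↔ Sym2.map Subtype.val e ∈ edgesIn (zdGraph d) Λ := by
  induction e using Sym2.ind with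
  | h a c =>
    rw [Sym2.map_mk, mem_edgesIn_iff, SimpleGraph.mem_edgeSet]
    constructor
    · intro he
      obtain ⟨e', he', hee'⟩ := Finset.mem_map.1 he
      induction e' using Sym2.ind with
      | h a' c' =>
        rw [mem_edgeFinset, SimpleGraph.mem_edgeSet, finsetGraph_adj_iff] at he'
        rw [edgeLift_mk, Sym2.eq_iff] at hee'
        rcases hee' with ⟨rfl, rfl⟩ | ⟨rfl, rfl⟩
        · exact ⟨he', by simp [finsetIncl_coe]⟩
        · exact ⟨he'.symm, by simp [finsetIncl_coe]⟩
    · rintro ⟨hadj, hmem⟩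
      have ha : a.1 ∈ Λ := hmem _ (Sym2.mem_mk_left _ _)
      have hc : c.1 ∈ Λ := hmem _ (Sym2.mem_mk_right _ _)
      refine Finset.mem_map.2 ⟨s(⟨a.1, ha⟩, ⟨c.1, hc⟩), ?_, ?_⟩
      · rw [mem_edgeFinset, SimpleGraph.mem_edgeSet, finsetGraph_adj_iff]; exact hadj
      · rw [edgeLift_mk]; rfl

/-- Reading an event of `ℤ^d` determined by the pairs `F` through `liftEdges Δ`: if every pair of `Δ` over `F`
lies in `R`, the pull-back only depends on the configuration on `R`. [cite: Grimmett2006, §4.2] -/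
theorem mem_preimage_liftEdges_iff_inter {Δ : Finset (Site d)} {F : Set (Sym2 (Site d))} {R : Set (Sym2 ↥Δ)}
    (hR : ∀ e : Sym2 ↥Δ, Sym2.map Subtype.val e ∈ F → e ∈ R) {X : Set (BondConfig (Site d))}
    (hX : DeterminedBy X F) (ω : BondConfig ↥Δ) :
    ω ∈ liftEdges Δ ⁻¹' X ↔ ω ∩ R ∈ liftEdges Δ ⁻¹' X := by
  rw [Set.mem_preimage, Set.mem_preimage]
  refine (determinedBy_iff _ _).1 hX _ _ ?_
  ext e
  simp only [Set.mem_inter_iff, mem_liftEdges_iff]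
  constructor
  · rintro ⟨⟨e', he', rfl⟩, heF⟩
    exact ⟨⟨e', ⟨he', hR e' heF⟩, rfl⟩, heF⟩
  · rintro ⟨⟨e', he', rfl⟩, heF⟩
    exact ⟨⟨e', he'.1, rfl⟩, heF⟩

/-- Lifting through the inclusion `Λ ⊆ Δ` and then to `ℤ^d` is lifting to `ℤ^d`. [cite: Grimmett2006, §4.2] -/
theorem liftEdges_coe_map_edgeLift {Λ Δ : Finset (Site d)} (h : Λ ⊆ Δ) (ω : Finset (Sym2 ↥Λ)) :
    liftEdges Δ (↑(ω.map (edgeLift h)) : BondConfig ↥Δ) = liftEdges Λ ↑ω := by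
  ext e
  simp only [mem_liftEdges_iff, Finset.coe_map, Set.mem_image, Finset.mem_coe]
  constructor
  · rintro ⟨_, ⟨e', he', rfl⟩, rfl⟩
    refine ⟨e', he', ?_⟩
    induction e' using Sym2.ind with
    | h a c => simp [finsetInclEmb]
  · rintro ⟨e', he', rfl⟩
    refine ⟨edgeLift h e', ⟨e', he', rfl⟩, ?_⟩
    induction e' using Sym2.ind with
    | h a c => simp [finsetInclEmb]

/-- The edge set of the spanning graph of the inner edges is the image of `E_Λ` (the hypothesis of the tree's
embedding identifications `rcMeasure_real_map_image` / `_of_wired`). [cite: Grimmett2006, Lemma (4.13)] -/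
theorem edgeFinset_fromEdgeSet_insideEdges {Λ Δ : Finset (Site d)} (h : Λ ⊆ Δ)
    (i : Fintype (fromEdgeSet (↑(insideEdges (zdGraph d) h) : Set (Sym2 ↥Δ))).edgeSet) :
    @SimpleGraph.edgeFinset _ (fromEdgeSet (↑(insideEdges (zdGraph d) h) : Set (Sym2 ↥Δ))) i =
      (finsetGraph (zdGraph d) Λ).edgeFinset.map (finsetInclEmb h).sym2Map := by
  convert edgeFinset_fromEdgeSet_of_subset (G := finsetGraph (zdGraph d) Δ) _ (insideEdges_subset_edgeFinset h)
  rfl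

/-- **Free transport**: the free measure of the spanning graph of the inner edges of `Λ` inside `Δ`, on the
pull-back of a `ℤ^d`-event, is the free measure of the region `Λ` (Grimmett 2006, Lemma (4.13): "the measure
on the sub-box is the measure of the sub-box"; tree: `rcMeasure_real_map_image`, idle vertices isolated).
[cite: Grimmett2006, Lemma (4.13)] -/
theorem rcMeasure_fromEdgeSet_insideEdges_empty_real {p q : ℝ} (hp : p ∈ Set.Icc (0 : ℝ) 1) (hq : 0 < q)
    {Λ Δ : Finset (Site d)} (h : Λ ⊆ Δ) (A : Set (BondConfig (Site d))) :
    (rcMeasure (fromEdgeSet (↑(insideEdges (zdGraph d) h) : Set (Sym2 ↥Δ))) p q ∅).real (liftEdges Δ ⁻¹' A) =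
      (rcMeasure (finsetGraph (zdGraph d) Λ) p q ∅).real (liftEdges Λ ⁻¹' A) := by
  have hmain := rcMeasure_real_map_image (finsetInclEmb h) (G := finsetGraph (zdGraph d) Λ)
    (G' := fromEdgeSet (↑(insideEdges (zdGraph d) h) : Set (Sym2 ↥Δ)))
    (edgeFinset_fromEdgeSet_insideEdges h _) hp hq ∅ (A := liftEdges Λ ⁻¹' A) (A' := liftEdges Δ ⁻¹' A)
    (fun ω _ => by rw [Set.mem_preimage, Set.mem_preimage, liftEdges_coe_map_edgeLift h ω])
  rw [Set.image_empty] at hmain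
  exact hmain

/-- **Wired transport**: the measure of the spanning graph of the inner edges of `Λ` inside `Δ` with every vertex
off `Λ` and all of `∂Λ` wired (the tree's `envSet`), on the pull-back of a `ℤ^d`-event, is the wired measure of the region `Λ`
(tree: `rcMeasure_real_map_of_wired`, idle vertices wired; needs `∂Λ ≠ ∅`). [cite: Grimmett2006, Lemma (4.13)] -/
theorem rcMeasure_fromEdgeSet_insideEdges_envSet_real {p q : ℝ} (hp : p ∈ Set.Icc (0 : ℝ) 1) (hq : 0 < q)
    {Λ Δ : Finset (Site d)} (h : Λ ⊆ Δ) (hW : (wiredBoundary (zdGraph d) Λ).Nonempty)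
    (A : Set (BondConfig (Site d))) :
    (rcMeasure (fromEdgeSet (↑(insideEdges (zdGraph d) h) : Set (Sym2 ↥Δ))) p q (envSet (zdGraph d) Λ Δ)).real
        (liftEdges Δ ⁻¹' A) =
      (rcMeasure (finsetGraph (zdGraph d) Λ) p q (wiredBoundary (zdGraph d) Λ)).real (liftEdges Λ ⁻¹' A) := by
  refine rcMeasure_real_map_of_wired (finsetInclEmb h) (G := finsetGraph (zdGraph d) Λ)
    (G' := fromEdgeSet (↑(insideEdges (zdGraph d) h) : Set (Sym2 ↥Δ)))
    (edgeFinset_fromEdgeSet_insideEdges h _) hp hq hW (W' := envSet (zdGraph d) Λ Δ) (fun u => ?_)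
    (A := liftEdges Λ ⁻¹' A) (A' := liftEdges Δ ⁻¹' A)
    (fun ω _ => by rw [Set.mem_preimage, Set.mem_preimage, liftEdges_coe_map_edgeLift h ω])
  -- `u ∈ envSet ↔ every preimage of u under the inclusion lies in ∂Λ`
  simp only [envSet, Set.mem_setOf_eq, mem_wiredBoundary_iff]
  constructor
  · rintro (hu | hu) x rfl
    · exact absurd x.2 hu
    · exact hu
  · intro H
    by_cases hu : u.1 ∈ Λ
    · exact Or.inr (H ⟨u.1, hu⟩ (Subtype.ext rfl))
    · exact Or.inl hu

/-- Every ambient boundary vertex of `Δ` that lies in `Λ ⊆ Δ` is a boundary vertex of `Λ`; hence the wired set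
of `Δ` is contained in `envSet (zdGraph d) Λ Δ`. [cite: Grimmett2006, §4.2] -/
theorem wiredBoundary_subset_envSet {Λ Δ : Finset (Site d)} (h : Λ ⊆ Δ) :
    wiredBoundary (zdGraph d) Δ ⊆ envSet (zdGraph d) Λ Δ := by
  intro x hx
  rw [mem_wiredBoundary_iff, mem_innerBoundary_iff] at hx
  by_cases hxΛ : x.1 ∈ Λ
  · obtain ⟨-, y, hy, hxy⟩ := hx
    exact Or.inr (mem_innerBoundary_iff.2 ⟨hxΛ, y, fun hyΛ => hy (h hyΛ), hxy⟩)
  · exact Or.inl hxΛ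

/-- An edge of `Δ` that is not an inner edge of `Λ` has its endpoints in `envSet (zdGraph d) Λ Δ` (an endpoint inside
`Λ` is then adjacent to a vertex outside `Λ`, i.e. lies on `∂Λ`). [cite: Grimmett2006, §4.2] -/
theorem mem_envSet_of_mem_edgeSet_of_notMem_insideEdges {Λ Δ : Finset (Site d)} (h : Λ ⊆ Δ) {e : Sym2 ↥Δ}
    (he : e ∈ (finsetGraph (zdGraph d) Δ).edgeSet) (heU : e ∉ (↑(insideEdges (zdGraph d) h) : Set (Sym2 ↥Δ))) :
    ∀ x ∈ e, x ∈ envSet (zdGraph d) Λ Δ := by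
  rw [Finset.mem_coe, mem_insideEdges_iff_map_val_mem_edgesIn, mem_edgesIn_iff] at heU
  induction e using Sym2.ind with
  | h a c =>
    rw [SimpleGraph.mem_edgeSet, finsetGraph_adj_iff] at he
    have hnot : ¬ (a.1 ∈ Λ ∧ c.1 ∈ Λ) := by
      intro hac
      apply heU
      refine ⟨(SimpleGraph.mem_edgeSet _).2 (by simpa using he), ?_⟩
      intro x hx
      rw [Sym2.map_mk, Sym2.mem_iff] at hx
      rcases hx with rfl | rfl
      · exact hac.1
      · exact hac.2
    intro x hx
    rw [Sym2.mem_iff] at hx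
    rcases hx with rfl | rfl
    · by_cases hx : x.1 ∈ Λ
      · exact Or.inr (mem_innerBoundary_iff.2 ⟨hx, c.1, fun hc => hnot ⟨hx, hc⟩, he⟩)
      · exact Or.inl hx
    · by_cases hx : x.1 ∈ Λ
      · exact Or.inr (mem_innerBoundary_iff.2 ⟨hx, a.1, fun ha => hnot ⟨ha, hx⟩, he.symm⟩)
      · exact Or.inl hx

/-- A finite region of `ℤ^d` containing an edge has a non-empty inner vertex boundary (walk from an endpoint along
the edge's direction until leaving the finite region). [cite: Grimmett2006, §4.2 (∂Λ)] -/
theorem wiredBoundary_nonempty_of_edgesIn_nonempty {Λ : Finset (Site d)}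
    (hE : (edgesIn (zdGraph d) Λ).Nonempty) : (wiredBoundary (zdGraph d) Λ).Nonempty := by
  obtain ⟨e, he⟩ := hE
  induction e using Sym2.ind with
  | h x y =>
    rw [mem_edgesIn_iff, SimpleGraph.mem_edgeSet] at he
    obtain ⟨hadj, hmem⟩ := he
    have hx : x ∈ Λ := hmem x (Sym2.mem_mk_left _ _)
    obtain ⟨i, hi⟩ := (zdGraph_adj_iff x y).1 hadj
    -- the ray `k ↦ x + k • e_i` leaves the finite set `Λ`
    set v : Site d := Pi.single i 1 with hv
    have hinj : Function.Injective fun k : ℕ => x + (k : ℤ) • v := by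
      intro k l hkl
      have h1 := congrFun hkl i
      simp only [hv, Pi.add_apply, Pi.smul_apply, Pi.single_eq_same, smul_eq_mul, mul_one,
        add_right_inj, Nat.cast_inj] at h1
      exact h1
    have hex : ∃ k : ℕ, x + (k : ℤ) • v ∉ Λ := by
      by_contra hall
      push Not at hall
      exact not_injective_infinite_finite (fun k : ℕ => (⟨x + (k : ℤ) • v, hall k⟩ : ↥Λ))
        (fun k l hkl => hinj (congrArg Subtype.val hkl))
    classical
    let k₀ := Nat.find hex
    have hk₀ : x + (k₀ : ℤ) • v ∉ Λ := Nat.find_spec hex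
    have hk₀pos : 0 < k₀ := by
      rcases Nat.eq_zero_or_pos k₀ with h0 | h0
      · exfalso; apply hk₀; rw [h0]; simpa using hx
      · exact h0
    obtain ⟨k, hk⟩ : ∃ k, k₀ = k + 1 := Nat.exists_eq_succ_of_ne_zero hk₀pos.ne'
    have hkin : x + (k : ℤ) • v ∈ Λ := by
      have := Nat.find_min hex (m := k) (by omega)
      simpa using this
    refine ⟨⟨x + (k : ℤ) • v, hkin⟩, ?_⟩
    rw [mem_wiredBoundary_iff, mem_innerBoundary_iff]
    refine ⟨hkin, x + (k₀ : ℤ) • v, hk₀, ?_⟩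
    rw [zdGraph_adj_iff]
    refine ⟨i, Or.inl ?_⟩
    rw [hk]
    push_cast
    rw [add_smul, one_smul, add_assoc]

end Lattice

end Summit.CriticalPhenomena.PercolationContinuityZ3.Theorems.FK

end
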